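import Mathlib
import Literature.Computability.Complexity.CliqueThresholdBounds
import HarnessLib

/-!
# Route NegLimited — ladder support `SubcriticalNullMass` (line `density-ladder`, stub 3; rung F-N1/p3, ROUND-9 §B)

Registered stub `stub_subcriticalNullMass` of the skeleton `density-ladder`
(HOME/pnp-ideate-p3/r9/ladder/Skeleton-R9-ladder.lean) on the support item
`NegLimited.NeglimitedLogOverOmegaNegations` (stmt-PneNP-19555): the first-moment lower bound for the
probability that `G(n, q)` has NO `k`-clique, `Pr[cliqueFn n k = 0] ≥ 1 - 2ν` whenever
`C(n,k) q^{C(k,2)} ≤ ν ≤ 1/2` (`k ≤ n`, `0 ≤ q ≤ 1`).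

Proof: the tree's Harris bound `exp_le_gnpProb_cliqueFree`
(`Pr[ω_k = 0] ≥ exp(-2 C(n,k) q^{C(k,2)})`, applicable since `q^{C(k,2)} ≤ C(n,k) q^{C(k,2)} ≤ 1/2`
because `C(n,k) ≥ 1`), then `1 - x ≤ e^{-x}` (`Real.add_one_le_exp`) and `{ω_k = 0} = {cliqueFn = 0}`
(`cliqueCount_eq_zero_iff`).
-/

set_option linter.dupNamespace false -- `Summit.PneNP.PneNP.…`: summit = sub-problem name (D-0017 single-conjunct layout)

namespace Summit.PneNP.PneNP.Theorems.NegLimitedLadder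

open Finset Filter
open Literature.Computability.Complexity

/-- The stub statement `SubcriticalNullMass` (verbatim from the registered skeleton `density-ladder`):
`Pr[ω_k(G(n,q)) = 0] ≥ 1 - 2ν` whenever `C(n,k) q^{C(k,2)} ≤ ν ≤ 1/2`. -/
def SubcriticalNullMass : Prop :=
  ∀ (n k : ℕ) (q ν : ℝ), k ≤ n → 0 ≤ q → q ≤ 1 → ((n.choose k : ℕ) : ℝ) * q ^ k.choose 2 ≤ ν → ν ≤ 1 / 2 →
    1 - 2 * ν ≤ gnpProb n q (univ.filter fun x => cliqueFn n k x = false)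

/-- **Stub 3 of line `density-ladder` PROVED** (`SubcriticalNullMass`, by name): first moment through
the Harris bound `exp_le_gnpProb_cliqueFree`. -/
theorem stub_subcriticalNullMass : SubcriticalNullMass := by
  intro n k q ν hkn hq0 hq1 hν hν2
  have hC1 : (1 : ℝ) ≤ ((n.choose k : ℕ) : ℝ) := by exact_mod_cast Nat.choose_pos hkn
  have hq0' : 0 ≤ q ^ k.choose 2 := pow_nonneg hq0 _
  have hpk : q ^ k.choose 2 ≤ 1 / 2 := by nlinarith
  have hH := exp_le_gnpProb_cliqueFree (n := n) hq0 hq1 k hpk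
  have hexp : 1 - 2 * ν ≤ Real.exp (-(2 * ((n.choose k : ℝ) * q ^ k.choose 2))) := by
    have h := Real.add_one_le_exp (-(2 * ((n.choose k : ℝ) * q ^ k.choose 2)))
    linarith
  have hset : (univ.filter fun x => cliqueFn n k x = false) =
      (univ.filter fun x => cliqueCount n k x = 0) := by
    ext x
    simp only [mem_filter, mem_univ, true_and, cliqueCount_eq_zero_iff]
  rw [hset]
  exact hexp.trans hH

end Summit.PneNP.PneNP.Theorems.NegLimitedLadder
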